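import Mathlib.Analysis.Convex.Slope
import Literature.MathematicalPhysics.QuantumLattice.TIGroundEnergyDensityResponse
import Literature.MathematicalPhysics.QuantumLattice.InfVolFermionStateMixture
import Literature.MathematicalPhysics.QuantumLattice.HubbardEnergyDensityChemicalPotential
import HarnessLib

/-!
# The canonical class of translation-invariant states: a density-constrained (ε-)minimiser of the mean
# energy is a grand-canonical (ε-)minimiser for a chemical potential `μ` (Lagrange multiplier)

Topic `Literature/MathematicalPhysics/QuantumLattice`. Everything here is PROVED; no definition and no named
fact is introduced. Vocabulary of `InfVolFermionState.lean` / `TIGroundEnergyDensityResponse.lean`: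
translation-invariant states `ω : InfVolFermionState d` of the CAR algebra over `ℤ^d`, their `density` and
mean energy `ω.meanEnergy Ψ R` for an interaction `Ψ : FermionInteraction d` (any — e.g. the pair-SOURCED
`t–t'` Hubbard interaction `hubbardTTPrimeSourcedInteraction t t' U μ g h`, which conserves no particle
number), mixtures `InfVolFermionState.mix`, pencils `FermionInteraction.pencil`, the number interaction
`numberInteraction` (`e_n(ω) = ρ(ω)`), and `IsMeanEnergyMinimiser` (grand-canonical variational principle).

The CANONICAL CLASS at density `n` is `{ω translation invariant, ω.density = n}` — the comparator class of
fixed-filling numerics (DMRG / AFQMC at `δ = 1/8` with a pinning field: Xu et al. 2024; Qin et al. 2020) and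
of the tree's canonical-class response floors (`Summit.Ventures.….TISourcedMinimiserChordFloor`). THIS FILE is
the Lagrange-multiplier half of the "canonical-class KKT licence": it moves a density-constrained minimiser
into the GRAND-CANONICAL variational class, where the Bratteli–Kishimoto–Robinson theory (ground state ⇔
mean-energy minimiser) and hence the stationarity / state-optimality (KKT) rows live.

* §1 `ConvexOn.exists_supporting_slope` — a real convex function on a set has a supporting line at
  every point with points of the set on both sides (subgradient `μ = inf` of right secant slopes;
  elementary, from `ConvexOn.secant_mono`). Rockafellar, *Convex Analysis* Thm. 23.4 (one-dimensional case).
* §2 `exists_chemicalPotential_of_epsMinimiser` — MODEL-FREE, any `d`, any interaction `Ψ`, any `R`: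
  let `I ⊆ ℝ` be convex with a translation-invariant state of every density `m ∈ I` (feasibility), and
  let `ω` be translation invariant of density `n ∈ I` (with points of `I` on both sides of `n`) and an
  `ε`-MINIMISER of `e_Ψ` in its canonical class: `e_Ψ(ω) ≤ e_Ψ(σ) + ε` for every translation-invariant
  `σ` of density `n`. Then there is `μ ∈ ℝ` with
  `e_Ψ(ω) − μ n ≤ e_Ψ(σ) − μ ρ(σ) + ε` for EVERY translation-invariant `σ` with `ρ(σ) ∈ I`.
  Proof: the constrained ground-energy function `v(m) = inf {e_Ψ(σ) : σ TI, ρ(σ) = m}` is convex on `I`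
  (mixtures of translation-invariant states are translation invariant with affine density and energy,
  `InfVolFermionStateMixture`), `μ` is a subgradient of `v` at `n` (§1), and `e_Ψ(ω) ≤ v(n) + ε`.
  Ruelle 1969 §3.4 (the chemical potential as the conjugate of the density; tangents to the convex energy
  density); Rockafellar Thm. 28.3 (Lagrange multipliers for convex programmes).
* §3 `d = 2`: every density in `[0,2)` is feasible (`exists_isTranslationInvariant_density_eq_two`, a torus
  limit of Hubbard sector ground states), hence for `n ∈ (0,2)`:
  `exists_chemicalPotential_of_epsMinimiser_two` (all translation-invariant `σ` with `ρ(σ) < 2`) and, by a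
  mixing-limit argument at the endpoint `ρ = 2`, `exists_chemicalPotential_of_epsMinimiser_two'` (ALL
  translation-invariant `σ`); in pencil form `epsMinimiser_pencil_number_of_canonical` (`ω` is an
  `ε`-minimiser of the `μ`-pencil `Ψ − μ·n` over all translation-invariant states) and, for `ε = 0`,
  `isMeanEnergyMinimiser_pencil_number_of_canonical`: **a canonical-class minimiser is a grand-canonical
  minimiser** `IsMeanEnergyMinimiser (pencil Ψ (numberInteraction 2) (−μ)) R` for some `μ`.

HONEST SCOPE / what is NOT here (the other half of the licence). For the `t–t'` Hubbard model with a chemical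
potential the tree proves «Bratteli–Robinson ground state ⇒ mean-energy minimiser» (Bratteli–Kishimoto–
Robinson 1978 Thm. 2, `1 ⇒ 2`: `FermionGroundStatesMinimiseMeanEnergy`,
`isMeanEnergyMinimiser_hubbardTTPrimeMu_of_groundState`) and, for Bratteli–Robinson ground states of ANY
interaction, the KKT rows (`IsGroundState.re_expect_conj_commutator_nonneg` = second-order rows for every
local `A`; `IsGroundState.expect_commutator_localHamiltonian_eq_zero` = first-order rows; for a
particle-number-CONSERVING `A` the `μN` term drops out of both commutators). The CONVERSE «translation-
invariant mean-energy minimiser ⇒ ground state» (BKR Thm. 2, `2 ⇒ 1`; Bratteli–Robinson II Thm. 6.2.58 for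
spin systems) is NOT in the tree and not proved here; with it, §3 turns every canonical-class minimiser of the
sourced interaction into a state satisfying ALL KKT rows of `H_h − μN` (charged and odd words included) and
the `μ`-free rows for `N`-conserving words. Exact minimisers of the canonical class are not shown to exist
here either (weak-* compactness; the `ε`-forms need none).

## References
* D. Ruelle, *Statistical Mechanics: Rigorous Results* (1969), §3.4. [cite: Ruelle1969, §3.4]
* R. T. Rockafellar, *Convex Analysis* (1970), Thm. 23.4, Thm. 28.3. [cite: Rockafellar1970, Thm. 28.3]
* O. Bratteli, A. Kishimoto, D. W. Robinson, Commun. Math. Phys. 64 (1978) 41, Thm. 2.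
  [cite: BratteliKishimotoRobinson1978, Thm. 2 (p. 47)]
* O. Bratteli, D. W. Robinson II (1997), §6.2.4 (mean values of translation-invariant states).
  [cite: BratteliRobinsonII1997, §6.2.4]
-/

noncomputable section

/-! ### §1 Supporting lines of real convex functions -/

/-- **Supporting line at a two-sided point.** A convex function `f` on `s ⊆ ℝ` admits, at every `n ∈ s`
having points of `s` strictly on both sides, a slope `μ` with `f n + μ (m − n) ≤ f m` for all `m ∈ s`
(`μ` = the infimum of the secant slopes to the right of `n`, which the secant slopes to the left bound from
below, `ConvexOn.secant_mono`). Rockafellar, *Convex Analysis*, Thm. 23.4 (`∂f(x) ≠ ∅` on the relative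
interior), one-dimensional case. [cite: Rockafellar1970, Thm. 23.4] -/
theorem ConvexOn.exists_supporting_slope {s : Set ℝ} {f : ℝ → ℝ} (hf : ConvexOn ℝ s f) {n : ℝ}
    (hn : n ∈ s) (hlo : ∃ x ∈ s, x < n) (hhi : ∃ y ∈ s, n < y) :
    ∃ μ : ℝ, ∀ m ∈ s, f n + μ * (m - n) ≤ f m := by
  obtain ⟨x₀, hx₀s, hx₀⟩ := hlo
  set T : Set ℝ := (fun y => (f y - f n) / (y - n)) '' {y | y ∈ s ∧ n < y} with hT
  have hTne : T.Nonempty := by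
    obtain ⟨y, hys, hy⟩ := hhi
    exact ⟨_, ⟨y, ⟨hys, hy⟩, rfl⟩⟩
  -- every left secant slope bounds every right secant slope from below
  have hleft : ∀ x ∈ s, x < n → ∀ τ ∈ T, (f x - f n) / (x - n) ≤ τ := by
    rintro x hxs hx _ ⟨y, ⟨hys, hy⟩, rfl⟩
    exact hf.secant_mono hn hxs hys hx.ne hy.ne' (hx.le.trans hy.le)
  have hTbdd : BddBelow T := ⟨_, fun τ hτ => hleft x₀ hx₀s hx₀ τ hτ⟩
  refine ⟨sInf T, fun m hms => ?_⟩
  rcases lt_trichotomy m n with hm | rfl | hm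
  · -- left of `n`: slope(m) ≤ inf T, and `m - n < 0`
    have h1 : (f m - f n) / (m - n) ≤ sInf T := le_csInf hTne (hleft m hms hm)
    have hneg : m - n < 0 := sub_neg.2 hm
    have h2 := (div_le_iff_of_neg hneg).1 h1
    linarith
  · simp
  · -- right of `n`: inf T ≤ slope(m), and `0 < m - n`
    have h1 : sInf T ≤ (f m - f n) / (m - n) := csInf_le hTbdd ⟨m, ⟨hms, hm⟩, rfl⟩
    have hpos : 0 < m - n := sub_pos.2 hm
    have h2 := (le_div_iff₀ hpos).1 h1
    linarith

namespace Literature.MathematicalPhysics.QuantumLattice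

open InfVolFermionState
open scoped Matrix.Norms.L2Operator

/-! ### §2 The Lagrange multiplier of the density constraint (model-free) -/

section ModelFree

variable {d : ℕ} (Ψ : FermionInteraction d) (R : ℝ)

/-- **Mixing to a prescribed convex combination of densities.** Translation-invariant `σ₁, σ₂` of
densities `x ≠ y` and weights `a, b ≥ 0`, `a + b = 1` give a translation-invariant state of density
`a x + b y` and mean energy `a e_Ψ(σ₁) + b e_Ψ(σ₂)` (for every `Ψ`, `R`). Bratteli–Robinson II §6.2.4
(affinity of mean values on the translation-invariant states). [cite: BratteliRobinsonII1997, §6.2.4] -/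
theorem exists_isTranslationInvariant_density_combo {σ₁ σ₂ : InfVolFermionState d}
    (h₁ : σ₁.IsTranslationInvariant) (h₂ : σ₂.IsTranslationInvariant) {x y a b : ℝ}
    (hx : σ₁.density = x) (hy : σ₂.density = y) (ha : 0 ≤ a) (hb : 0 ≤ b) (hab : a + b = 1) :
    ∃ σ : InfVolFermionState d, σ.IsTranslationInvariant ∧ σ.density = a * x + b * y ∧
      ∀ (Ψ : FermionInteraction d) (R : ℝ),
        σ.meanEnergy Ψ R = a * σ₁.meanEnergy Ψ R + b * σ₂.meanEnergy Ψ R := by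
  have ha1 : a ≤ 1 := by linarith
  refine ⟨mix a ha ha1 σ₁ σ₂, h₁.mix h₂ a ha ha1, ?_, fun Ψ R => ?_⟩
  · rw [density_mix, hx, hy]
    have : b = 1 - a := by linarith
    rw [this]
  · rw [meanEnergy_mix]
    have : b = 1 - a := by linarith
    rw [this]

/-- **Lagrange multiplier of the density constraint (canonical ⇒ grand-canonical, model-free).** Let
`I ⊆ ℝ` be convex, every density `m ∈ I` be carried by some translation-invariant state, and let `ω` be a
translation-invariant state of density `n ∈ I`, with points of `I` on both sides of `n`, which
`ε`-minimises the mean energy `e_Ψ` in its canonical class (`e_Ψ(ω) ≤ e_Ψ(σ) + ε` for all translation-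
invariant `σ` of density `n`). Then there is a chemical potential `μ` with
`e_Ψ(ω) − μ n ≤ e_Ψ(σ) − μ ρ(σ) + ε` for every translation-invariant `σ` of density in `I`: `ω`
`ε`-minimises `e_Ψ − μ ρ` on the grand-canonical class over `I`. (`μ` is a subgradient at `n` of the convex
constrained ground-energy function `m ↦ inf {e_Ψ(σ) : ρ(σ) = m}`.) Ruelle 1969 §3.4; Rockafellar 1970
Thm. 28.3. [cite: Ruelle1969, §3.4] [cite: Rockafellar1970, Thm. 28.3] -/
theorem exists_chemicalPotential_of_epsMinimiser {I : Set ℝ} (hI : Convex ℝ I)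
    (hfeas : ∀ m ∈ I, ∃ σ : InfVolFermionState d, σ.IsTranslationInvariant ∧ σ.density = m)
    {ω : InfVolFermionState d} {n : ℝ} (hn : n ∈ I)
    (hlo : ∃ m ∈ I, m < n) (hhi : ∃ m ∈ I, n < m) {ε : ℝ}
    (hmin : ∀ σ : InfVolFermionState d, σ.IsTranslationInvariant → σ.density = n →
      ω.meanEnergy Ψ R ≤ σ.meanEnergy Ψ R + ε) :
    ∃ μ : ℝ, ∀ σ : InfVolFermionState d, σ.IsTranslationInvariant → σ.density ∈ I →
      ω.meanEnergy Ψ R - μ * n ≤ σ.meanEnergy Ψ R - μ * σ.density + ε := by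
  classical
  -- the constrained ground-energy function
  set S : ℝ → Set ℝ := fun m =>
    (fun σ : InfVolFermionState d => σ.meanEnergy Ψ R) ''
      {σ : InfVolFermionState d | σ.IsTranslationInvariant ∧ σ.density = m} with hS
  set v : ℝ → ℝ := fun m => sInf (S m) with hv
  have hbdd : ∀ m, BddBelow (S m) := fun m => by
    refine ⟨-‖Ψ.meanEnergyObs R‖, ?_⟩
    rintro _ ⟨σ, -, rfl⟩
    exact (abs_le.1 (σ.abs_meanEnergy_le_norm Ψ R)).1
  have hne : ∀ m ∈ I, (S m).Nonempty := fun m hm => by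
    obtain ⟨σ, hσ, hσm⟩ := hfeas m hm
    exact ⟨_, ⟨σ, ⟨hσ, hσm⟩, rfl⟩⟩
  have hv_le : ∀ (σ : InfVolFermionState d), σ.IsTranslationInvariant →
      v σ.density ≤ σ.meanEnergy Ψ R := fun σ hσ =>
    csInf_le (hbdd _) ⟨σ, ⟨hσ, rfl⟩, rfl⟩
  -- `ω` is within `ε` of the constrained infimum at `n`
  have hω_le : ω.meanEnergy Ψ R ≤ v n + ε := by
    have h : ω.meanEnergy Ψ R - ε ≤ v n := by
      refine le_csInf (hne n hn) ?_
      rintro _ ⟨σ, ⟨hσ, hσn⟩, rfl⟩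
      linarith [hmin σ hσ hσn]
    linarith
  -- `v` is convex on `I`
  have hconv : ConvexOn ℝ I v := by
    refine ⟨hI, fun x hx y hy a b ha hb hab => ?_⟩
    simp only [smul_eq_mul]
    by_cases hxy : x = y
    · subst hxy
      have h1 : a * x + b * x = x := by rw [← add_mul, hab, one_mul]
      have h2 : a * v x + b * v x = v x := by rw [← add_mul, hab, one_mul]
      rw [h1, h2]
    refine le_of_forall_pos_le_add fun δ hδ => ?_
    obtain ⟨_, ⟨σ₁, ⟨hσ₁, hσ₁x⟩, rfl⟩, h₁⟩ := (csInf_lt_iff (hbdd x) (hne x hx)).1 (lt_add_of_pos_right (v x) hδ)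
    obtain ⟨_, ⟨σ₂, ⟨hσ₂, hσ₂y⟩, rfl⟩, h₂⟩ := (csInf_lt_iff (hbdd y) (hne y hy)).1 (lt_add_of_pos_right (v y) hδ)
    obtain ⟨σ, hσ, hσd, hσe⟩ := exists_isTranslationInvariant_density_combo hσ₁ hσ₂ hσ₁x hσ₂y ha hb hab
    have hvσ : v (a * x + b * y) ≤ σ.meanEnergy Ψ R := by rw [← hσd]; exact hv_le σ hσ
    rw [hσe Ψ R] at hvσ
    have h₁' : a * σ₁.meanEnergy Ψ R ≤ a * (v x + δ) := mul_le_mul_of_nonneg_left h₁.le ha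
    have h₂' : b * σ₂.meanEnergy Ψ R ≤ b * (v y + δ) := mul_le_mul_of_nonneg_left h₂.le hb
    nlinarith
  -- a subgradient of `v` at `n`
  obtain ⟨μ, hμ⟩ := hconv.exists_supporting_slope hn hlo hhi
  refine ⟨μ, fun σ hσ hσI => ?_⟩
  have h1 := hμ σ.density hσI
  have h2 := hv_le σ hσ
  linarith

end ModelFree

/-! ### §3 The square lattice: every density in `[0,2)` is feasible -/

section Square

variable (Ψ : FermionInteraction 2) (R : ℝ)

/-- **Feasibility on `ℤ²`**: every density `m ∈ [0,2)` is the density of some translation-invariant state (a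
torus limit of sector ground states of the Hubbard model, `exists_isTorusLimitOf_squareGroundStatesTT'_meanEnergy_eq`).
[cite: Ruelle1969, §3.4] -/
theorem exists_isTranslationInvariant_density_eq_two {m : ℝ} (hm0 : 0 ≤ m) (hm2 : m < 2) :
    ∃ σ : InfVolFermionState 2, σ.IsTranslationInvariant ∧ σ.density = m := by
  obtain ⟨-, -, σ, -, -, hti, -, -, -, hdens, -, -⟩ :=
    exists_isTorusLimitOf_squareGroundStatesTT'_meanEnergy_eq (t := 1) (t' := 0) (le_refl (0 : ℝ)) hm0 hm2
  exact ⟨σ, hti, hdens⟩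

/-- **Chemical potential of a canonical-class `ε`-minimiser on `ℤ²`** (densities below `2`): for `ω`
translation invariant of density `n ∈ (0,2)` with `e_Ψ(ω) ≤ e_Ψ(σ) + ε` for all translation-invariant `σ`
of density `n`, there is `μ` with `e_Ψ(ω) − μ n ≤ e_Ψ(σ) − μ ρ(σ) + ε` for every translation-invariant `σ`
of density `< 2`. Any interaction `Ψ` (e.g. the pair-sourced `hubbardTTPrimeSourcedInteraction`), any `R`.
[cite: Ruelle1969, §3.4] [cite: Rockafellar1970, Thm. 28.3] -/
theorem exists_chemicalPotential_of_epsMinimiser_two {ω : InfVolFermionState 2} {n : ℝ}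
    (hn0 : 0 < n) (hn2 : n < 2) {ε : ℝ}
    (hmin : ∀ σ : InfVolFermionState 2, σ.IsTranslationInvariant → σ.density = n →
      ω.meanEnergy Ψ R ≤ σ.meanEnergy Ψ R + ε) :
    ∃ μ : ℝ, ∀ σ : InfVolFermionState 2, σ.IsTranslationInvariant → σ.density < 2 →
      ω.meanEnergy Ψ R - μ * n ≤ σ.meanEnergy Ψ R - μ * σ.density + ε := by
  obtain ⟨μ, hμ⟩ := exists_chemicalPotential_of_epsMinimiser Ψ R (convex_Ico 0 2)
    (fun m hm => exists_isTranslationInvariant_density_eq_two hm.1 hm.2) ⟨hn0.le, hn2⟩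
    ⟨0, ⟨le_refl _, two_pos⟩, hn0⟩ ⟨(n + 2) / 2, ⟨by linarith, by linarith⟩, by linarith⟩ hmin
  exact ⟨μ, fun σ hσ hσ2 => hμ σ hσ ⟨σ.density_nonneg, hσ2⟩⟩

/-- The `ε` of an `ε`-minimiser is nonnegative (compare `ω` with itself). [folklore] -/
private theorem eps_nonneg {ω : InfVolFermionState 2} {n ε : ℝ} (hω : ω.IsTranslationInvariant)
    (hρ : ω.density = n)
    (hmin : ∀ σ : InfVolFermionState 2, σ.IsTranslationInvariant → σ.density = n →
      ω.meanEnergy Ψ R ≤ σ.meanEnergy Ψ R + ε) : 0 ≤ ε := by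
  linarith [hmin ω hω hρ]

/-- Endpoint arithmetic: if `λ (ε − D) ≤ ε` for all `λ ∈ [0,1)` and `0 ≤ ε`, then `0 ≤ D`. [folklore] -/
private theorem nonneg_of_forall_mul_sub_le {ε D : ℝ} (hε : 0 ≤ ε)
    (h : ∀ l : ℝ, 0 ≤ l → l < 1 → l * (ε - D) ≤ ε) : 0 ≤ D := by
  by_contra hD
  rw [not_le] at hD
  have hpos : 0 < ε - D := by linarith
  -- the midpoint between `ε/(ε − D)` and `1`
  have hl0 : 0 ≤ (2 * ε - D) / (2 * (ε - D)) := div_nonneg (by linarith) (by linarith)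
  have hl1 : (2 * ε - D) / (2 * (ε - D)) < 1 := (div_lt_one (by linarith)).2 (by linarith)
  have hval : (2 * ε - D) / (2 * (ε - D)) * (ε - D) = ε - D / 2 := by
    rw [div_mul_eq_mul_div, div_eq_iff (ne_of_gt (by linarith))]
    ring
  have := h _ hl0 hl1
  rw [hval] at this
  linarith

/-- **Chemical potential of a canonical-class `ε`-minimiser on `ℤ²`, all comparison states**: as
`exists_chemicalPotential_of_epsMinimiser_two`, for EVERY translation-invariant `σ` (the endpoint `ρ(σ) = 2`
by mixing `σ` with `ω` and letting the weight tend to `1`). [cite: Ruelle1969, §3.4]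
[cite: Rockafellar1970, Thm. 28.3] -/
theorem exists_chemicalPotential_of_epsMinimiser_two' {ω : InfVolFermionState 2} (hω : ω.IsTranslationInvariant)
    {n : ℝ} (hρ : ω.density = n) (hn0 : 0 < n) (hn2 : n < 2) {ε : ℝ}
    (hmin : ∀ σ : InfVolFermionState 2, σ.IsTranslationInvariant → σ.density = n →
      ω.meanEnergy Ψ R ≤ σ.meanEnergy Ψ R + ε) :
    ∃ μ : ℝ, ∀ σ : InfVolFermionState 2, σ.IsTranslationInvariant →
      ω.meanEnergy Ψ R - μ * n ≤ σ.meanEnergy Ψ R - μ * σ.density + ε := by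
  obtain ⟨μ, hμ⟩ := exists_chemicalPotential_of_epsMinimiser_two Ψ R hn0 hn2 hmin
  refine ⟨μ, fun σ hσ => ?_⟩
  rcases lt_or_eq_of_le σ.density_le_two with hlt | heq
  · exact hμ σ hσ hlt
  -- `ρ(σ) = 2`: mixtures `l σ + (1 − l) ω`, `l < 1`, have density `< 2`
  have hε := eps_nonneg Ψ R hω hρ hmin
  have key : ∀ l : ℝ, 0 ≤ l → l < 1 →
      l * (ε - ((σ.meanEnergy Ψ R - μ * σ.density + ε) - (ω.meanEnergy Ψ R - μ * n))) ≤ ε := by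
    intro l hl0 hl1
    have h := hμ (mix l hl0 hl1.le σ ω) (hσ.mix hω l hl0 hl1.le) (by
      rw [density_mix, heq, hρ]; nlinarith)
    rw [meanEnergy_mix, density_mix, heq, hρ] at h
    rw [heq]
    nlinarith
  have hD := nonneg_of_forall_mul_sub_le hε key
  linarith

/-- **Pencil form**: a canonical-class `ε`-minimiser `ω` (density `n ∈ (0,2)`) `ε`-minimises the `μ`-pencil
`Ψ − μ·n` (`FermionInteraction.pencil Ψ (numberInteraction 2) (−μ)`, mean energy `e_Ψ − μ ρ`) over ALL
translation-invariant states of `ℤ²`, for some `μ`. [cite: Ruelle1969, §3.4] [cite: Rockafellar1970, Thm. 28.3] -/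
theorem epsMinimiser_pencil_number_of_canonical {ω : InfVolFermionState 2} (hω : ω.IsTranslationInvariant)
    {n : ℝ} (hρ : ω.density = n) (hn0 : 0 < n) (hn2 : n < 2) {ε : ℝ}
    (hmin : ∀ σ : InfVolFermionState 2, σ.IsTranslationInvariant → σ.density = n →
      ω.meanEnergy Ψ R ≤ σ.meanEnergy Ψ R + ε) :
    ∃ μ : ℝ, ∀ σ : InfVolFermionState 2, σ.IsTranslationInvariant →
      ω.meanEnergy (FermionInteraction.pencil Ψ (numberInteraction 2) (-μ)) R ≤
        σ.meanEnergy (FermionInteraction.pencil Ψ (numberInteraction 2) (-μ)) R + ε := by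
  obtain ⟨μ, hμ⟩ := exists_chemicalPotential_of_epsMinimiser_two' Ψ R hω hρ hn0 hn2 hmin
  refine ⟨μ, fun σ hσ => ?_⟩
  have h := hμ σ hσ
  rw [meanEnergy_pencil, meanEnergy_pencil, meanEnergy_numberInteraction, meanEnergy_numberInteraction, hρ]
  linarith

/-- **A canonical-class minimiser is a grand-canonical minimiser for a chemical potential.** If `ω` is
translation invariant of density `n ∈ (0,2)` and minimises `e_Ψ` among translation-invariant states of density
`n` (EXACT minimiser, `ε = 0`), then for some `μ ∈ ℝ` it is a mean-energy minimiser of the `μ`-pencil: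
`ω.IsMeanEnergyMinimiser (pencil Ψ (numberInteraction 2) (−μ)) R` — the hypothesis under which
Bratteli–Kishimoto–Robinson's theory of translation-invariant ground states applies (their Thm. 2 for the
interaction `Ψ − μn`; the direction «minimiser ⇒ ground state ⇒ KKT rows» is NOT proved in the tree, see the
module docstring). [cite: Ruelle1969, §3.4] [cite: BratteliKishimotoRobinson1978, Thm. 2 (p. 47)] -/
theorem isMeanEnergyMinimiser_pencil_number_of_canonical {ω : InfVolFermionState 2}
    (hω : ω.IsTranslationInvariant) {n : ℝ} (hρ : ω.density = n) (hn0 : 0 < n) (hn2 : n < 2)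
    (hmin : ∀ σ : InfVolFermionState 2, σ.IsTranslationInvariant → σ.density = n →
      ω.meanEnergy Ψ R ≤ σ.meanEnergy Ψ R) :
    ∃ μ : ℝ, ω.IsMeanEnergyMinimiser (FermionInteraction.pencil Ψ (numberInteraction 2) (-μ)) R := by
  obtain ⟨μ, hμ⟩ := epsMinimiser_pencil_number_of_canonical Ψ R hω hρ hn0 hn2 (ε := 0)
    (fun σ hσ hσn => by rw [add_zero]; exact hmin σ hσ hσn)
  exact ⟨μ, hω, fun σ hσ => by simpa using hμ σ hσ⟩

/-! ### §4 Certified envelope for the chemical potential (appended 2026-08-26)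

The multiplier `μ` of `exists_chemicalPotential_of_epsMinimiser_two'` is not computed, but the grand-canonical
inequality it satisfies BRACKETS it by data: one translation-invariant trial state above the density and one
below, together with certified bounds on `e_Ψ(ω)`, give `μ_ ≤ μ ≤ μ̄` — the envelope the charged KKT rows
consume (`StateRelaxation.re_map_kktForm_add_mul_nonneg_of_chargeLowering` needs `μ ≤ μ̄`,
`…_of_chargeRaising` needs `μ_ ≤ μ`). Ruelle 1969 §3.4 (chords of the convex energy density bound its
tangent slopes). -/

/-- **Upper envelope**: if `e_Ψ(ω) − μ n ≤ e_Ψ(σ) − μ ρ(σ) + ε` for the translation-invariant trial state `σ` of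
density `m > n`, then `μ ≤ (e_Ψ(σ) − e_Ψ(ω) + ε)/(m − n)`; with a certified lower bound `lo ≤ e_Ψ(ω)` and a
certified cap `e_Ψ(σ) ≤ hi`, `μ ≤ (hi − lo + ε)/(m − n)`. [cite: Ruelle1969, §3.4] -/
theorem chemicalPotential_le_of_trial_above {ω σ : InfVolFermionState 2} {n m μ ε lo hi : ℝ}
    (hμ : ω.meanEnergy Ψ R - μ * n ≤ σ.meanEnergy Ψ R - μ * σ.density + ε) (hσm : σ.density = m)
    (hm : n < m) (hlo : lo ≤ ω.meanEnergy Ψ R) (hhi : σ.meanEnergy Ψ R ≤ hi) :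
    μ ≤ (hi - lo + ε) / (m - n) := by
  rw [hσm] at hμ
  rw [le_div_iff₀ (sub_pos.2 hm)]
  nlinarith

/-- **Lower envelope**: if `e_Ψ(ω) − μ n ≤ e_Ψ(σ) − μ ρ(σ) + ε` for the translation-invariant trial state `σ` of
density `m < n`, then `(e_Ψ(ω) − ε − e_Ψ(σ))/(n − m) ≤ μ`; with certified `lo ≤ e_Ψ(ω)` and `e_Ψ(σ) ≤ hi`,
`(lo − hi − ε)/(n − m) ≤ μ`. [cite: Ruelle1969, §3.4] -/
theorem le_chemicalPotential_of_trial_below {ω σ : InfVolFermionState 2} {n m μ ε lo hi : ℝ}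
    (hμ : ω.meanEnergy Ψ R - μ * n ≤ σ.meanEnergy Ψ R - μ * σ.density + ε) (hσm : σ.density = m)
    (hm : m < n) (hlo : lo ≤ ω.meanEnergy Ψ R) (hhi : σ.meanEnergy Ψ R ≤ hi) :
    (lo - hi - ε) / (n - m) ≤ μ := by
  rw [hσm] at hμ
  rw [div_le_iff₀ (sub_pos.2 hm)]
  nlinarith

/-- **The multiplier with its certified envelope**, packaged: for a canonical-class `ε`-minimiser `ω` at
density `n ∈ (0,2)` with a certified floor `lo ≤ e_Ψ(ω)`, translation-invariant trial states `σ₋`, `σ₊` of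
densities `m₋ < n < m₊` with certified caps `e_Ψ(σ₋) ≤ hi₋`, `e_Ψ(σ₊) ≤ hi₊`, there is `μ` with the
grand-canonical `ε`-minimality AND `(lo − hi₋ − ε)/(n − m₋) ≤ μ ≤ (hi₊ − lo + ε)/(m₊ − n)`.
[cite: Ruelle1969, §3.4] [cite: Rockafellar1970, Thm. 28.3] -/
theorem exists_chemicalPotential_mem_Icc_of_epsMinimiser {ω σl σu : InfVolFermionState 2}
    (hω : ω.IsTranslationInvariant) {n : ℝ} (hρ : ω.density = n) (hn0 : 0 < n) (hn2 : n < 2) {ε : ℝ}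
    (hmin : ∀ σ : InfVolFermionState 2, σ.IsTranslationInvariant → σ.density = n →
      ω.meanEnergy Ψ R ≤ σ.meanEnergy Ψ R + ε)
    {lo ml mu hil hiu : ℝ} (hlo : lo ≤ ω.meanEnergy Ψ R)
    (hσl : σl.IsTranslationInvariant) (hml : σl.density = ml) (hmln : ml < n) (hhil : σl.meanEnergy Ψ R ≤ hil)
    (hσu : σu.IsTranslationInvariant) (hmu : σu.density = mu) (hnmu : n < mu) (hhiu : σu.meanEnergy Ψ R ≤ hiu) :
    ∃ μ : ℝ, (∀ σ : InfVolFermionState 2, σ.IsTranslationInvariant →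
        ω.meanEnergy Ψ R - μ * n ≤ σ.meanEnergy Ψ R - μ * σ.density + ε) ∧
      (lo - hil - ε) / (n - ml) ≤ μ ∧ μ ≤ (hiu - lo + ε) / (mu - n) := by
  obtain ⟨μ, hμ⟩ := exists_chemicalPotential_of_epsMinimiser_two' Ψ R hω hρ hn0 hn2 hmin
  exact ⟨μ, hμ, le_chemicalPotential_of_trial_below Ψ R (hμ σl hσl) hml hmln hlo hhil,
    chemicalPotential_le_of_trial_above Ψ R (hμ σu hσu) hmu hnmu hlo hhiu⟩

end Square

end Literature.MathematicalPhysics.QuantumLattice
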